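import Summits.HodgeConjecture.CorCM.Census.CyclicCharacterNearLinearisation
import Summits.HodgeConjecture.CorCM.Census.CyclicCharacterNearZone

/-!
# Cyclic characters, XVIII: THE BOTTOM WALK IN COORDINATES — deviations, the two linearisations, the block count of the near zone

COR-CM (cell `pub-hodgecm2`), count-neutral kernel combinatorics by the binder seat b09 (gen 42; lane CYCLIC-CHARACTER FIBRE LAW, part XVIII), the preparation for
part XIX (`Census/CyclicCharacterQuarticLaw.lean`: `μ(G, c) = β(G, c) − 1` for EVERY finite group with `G / ker w ≅ ℤ/4` and odd kernel — the ℤ/4-Sylow law), on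
parts XIV, XVII and gen 41ʼs `Census/CyclicCharacterNearZone.lean` BY NAME.  Theorems only (no definition, no `decide`, no certificate, no named fact, no `sorry`).
HONEST FRAMING: `HC_CM` is NOT proved, here or anywhere in the tree; nothing here is a period or a headline.

* §1 **Bottom-deviating types** `X` (`T_0 ∖ X ⊆ F_0 = w⁻¹(0)`): their deviation from `T_1` is `c·(F_0 ∖ (T_0 ∖ X))` (`sdiff_arcType_one_eq_image`, any `k`), so
  `ddist T_0 X = |T_0 ∖ X|` and `ddist T_1 X = |F_0| − |T_0 ∖ X|` (`ddist_arcType_one_eq`); their `T_1`-normal form is `[T_1] + Σ_{t ∈ F_0 ∖ (T_0∖X)} ([T_1^{(t)}] − [T_1])`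
  (`normalForm_one_eq`); flipping a further bottom point `t` adds `t` to the deviation (`BlockParity.dev_oflip_of_mem`) and every `B ⊆ F_0` is the deviation
  set of some type (`exists_sdiff_eq_of_subset_fibre`).
* §2 **The near zone has at least three blocks** (`three_le_card_filter_bpot_le_one`): the arc block, the bottom flips and the top flips (`k = 2`; kernel with an
  element of odd order `≠ 1`), so gen 38ʼs cover has at most `β − 3` members.
-/

namespace Summit.HodgeConjecture.CorCM.Census.CyclicCharacter

open Finset
open Summit.HodgeConjecture.CorCM.Prior.AllgGroup.RfwfAllgGroup
open Summit.HodgeConjecture.CorCM.Census.BlockParity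
open Summit.HodgeConjecture.CorCM.Census.Coinvariant
open Summit.HodgeConjecture.CorCM.Census.TwistGeneration
open Summit.HodgeConjecture.CorCM.Census.Nondegenerate
open Summit.HodgeConjecture.CorCM.Census.BaseBlock

noncomputable section

variable {G : Type*} [Group G] [Fintype G] [DecidableEq G] {k : ℕ} {w : G → ZMod (2 ^ k)} {c : G}

/-! ## §1 Bottom-deviating types -/

/-- `x ∈ T_1 ∖ T_0 ↔ c·x ∈ T_0 ∖ T_1 ↔ w (c x) = 0`. [folklore] -/
theorem mem_arcType_one_sdiff_zero_iff (hw : ∀ P Q : G, w (P * Q) = w P + w Q) (hk : 1 ≤ k) (hc2 : c * c = 1) (hwc : w c ≠ 0) (x : G) :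
    x ∈ (arcType hw hk hc2 hwc 1).1 \ (arcType hw hk hc2 hwc 0).1 ↔ w (c * x) = 0 := by
  rw [← mem_sdiff_arcType_one_iff hw hk hc2 hwc (c * x), mem_sdiff, mem_sdiff]
  have h0 := (arcType hw hk hc2 hwc 0).2 x
  have h1 := (arcType hw hk hc2 hwc 1).2 x
  have h1' : c * x ∈ (arcType hw hk hc2 hwc 1).1 ↔ x ∉ (arcType hw hk hc2 hwc 1).1 := by
    have := (arcType hw hk hc2 hwc 1).2 (c * x)
    rw [← mul_assoc, hc2, one_mul] at this
    tauto
  tauto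

/-- **The `T_1`-deviation of a bottom-deviating type**: if `T_0 ∖ X ⊆ F_0` then `T_1 ∖ X = c·(F_0 ∖ (T_0 ∖ X))`. [folklore] -/
theorem sdiff_arcType_one_eq_image (hw : ∀ P Q : G, w (P * Q) = w P + w Q) (hk : 1 ≤ k) (hc2 : c * c = 1) (hwc : w c ≠ 0) (X : CMF G c)
    (hX : (arcType hw hk hc2 hwc 0).1 \ X.1 ⊆ univ.filter fun s => w s = 0) :
    (arcType hw hk hc2 hwc 1).1 \ X.1 = ((univ.filter fun s => w s = 0) \ ((arcType hw hk hc2 hwc 0).1 \ X.1)).image fun s => c * s := by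
  ext x
  rw [mem_image]
  constructor
  · intro hx
    have hxT1 : x ∈ (arcType hw hk hc2 hwc 1).1 := (mem_sdiff.mp hx).1
    have hxX : x ∉ X.1 := (mem_sdiff.mp hx).2
    -- `x ∉ T_0`: otherwise `x` deviates from `T_0`, hence is a bottom point, hence not in `T_1`
    have hxT0 : x ∉ (arcType hw hk hc2 hwc 0).1 := by
      intro h
      have hdev : x ∈ (arcType hw hk hc2 hwc 0).1 \ X.1 := mem_sdiff.mpr ⟨h, hxX⟩
      have hw0 : w x = 0 := (mem_filter.mp (hX hdev)).2
      exact (mem_arcType_zero_and_notMem_one hw hk hc2 hwc hw0).2 hxT1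
    have hcx : w (c * x) = 0 := (mem_arcType_one_sdiff_zero_iff hw hk hc2 hwc x).mp (mem_sdiff.mpr ⟨hxT1, hxT0⟩)
    refine ⟨c * x, mem_sdiff.mpr ⟨mem_filter.mpr ⟨mem_univ _, hcx⟩, fun h => ?_⟩, by rw [← mul_assoc, hc2, one_mul]⟩
    -- `c x ∉ X` would contradict `x ∉ X`
    exact (mem_sdiff.mp h).2 (by by_contra hcx; exact hxX ((X.2 x).mpr hcx))
  · rintro ⟨s, hs, rfl⟩
    have hs0 : w s = 0 := (mem_filter.mp (mem_sdiff.mp hs).1).2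
    have hsT0 : s ∈ (arcType hw hk hc2 hwc 0).1 := (mem_arcType_zero_and_notMem_one hw hk hc2 hwc hs0).1
    have hsX : s ∈ X.1 := by
      by_contra h
      exact (mem_sdiff.mp hs).2 (mem_sdiff.mpr ⟨hsT0, h⟩)
    refine mem_sdiff.mpr ⟨?_, (X.2 s).mp hsX⟩
    have h := (mem_arcType_one_sdiff_zero_iff hw hk hc2 hwc (c * s)).mpr (by rw [← mul_assoc, hc2, one_mul]; exact hs0)
    exact (mem_sdiff.mp h).1

/-- **Distances of a bottom-deviating type**: `ddist T_1 X + |T_0 ∖ X| = |F_0|`. [folklore] -/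
theorem ddist_arcType_one_add (hw : ∀ P Q : G, w (P * Q) = w P + w Q) (hk : 1 ≤ k) (hc2 : c * c = 1) (hwc : w c ≠ 0) (X : CMF G c)
    (hX : (arcType hw hk hc2 hwc 0).1 \ X.1 ⊆ univ.filter fun s => w s = 0) :
    ddist (arcType hw hk hc2 hwc 1) X + ((arcType hw hk hc2 hwc 0).1 \ X.1).card = (univ.filter fun s : G => w s = 0).card := by
  unfold ddist
  rw [sdiff_arcType_one_eq_image hw hk hc2 hwc X hX, card_image_of_injective _ (mul_right_injective c), card_sdiff_add_card_eq_card hX]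

/-- **The `T_1`-normal form of a bottom-deviating type** runs over the unflipped bottom points:
`Σ_{x ∈ T_1 ∖ X} ([T_1^{(x)}] − [T_1]) = Σ_{t ∈ F_0 ∖ (T_0∖X)} ([T_1^{(t)}] − [T_1])`. [folklore] -/
theorem normalForm_one_eq (hw : ∀ P Q : G, w (P * Q) = w P + w Q) (hk : 1 ≤ k) (hc2 : c * c = 1) (hwc : w c ≠ 0) (X : CMF G c)
    (hX : (arcType hw hk hc2 hwc 0).1 \ X.1 ⊆ univ.filter fun s => w s = 0) :
    (∑ x ∈ (arcType hw hk hc2 hwc 1).1 \ X.1,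
        (Finsupp.single (oflipCM c hc2 x (arcType hw hk hc2 hwc 1)) (1 : ℤ) - Finsupp.single (arcType hw hk hc2 hwc 1) 1)) =
      ∑ t ∈ (univ.filter fun s => w s = 0) \ ((arcType hw hk hc2 hwc 0).1 \ X.1),
        (Finsupp.single (oflipCM c hc2 t (arcType hw hk hc2 hwc 1)) (1 : ℤ) - Finsupp.single (arcType hw hk hc2 hwc 1) 1) := by
  rw [sdiff_arcType_one_eq_image hw hk hc2 hwc X hX, sum_image fun x _ y _ h => mul_left_cancel h]
  refine sum_congr rfl fun t _ => ?_
  rw [oflipCM_cmul]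

/-- **Every set of bottom points is a deviation set**: for `B ⊆ F_0` there is a type `X` with `T_0 ∖ X = B`. [folklore] -/
theorem exists_sdiff_eq_of_subset_fibre (hw : ∀ P Q : G, w (P * Q) = w P + w Q) (hk : 1 ≤ k) (hc2 : c * c = 1) (hwc : w c ≠ 0)
    (B : Finset G) (hB : B ⊆ univ.filter fun s => w s = 0) : ∃ X : CMF G c, (arcType hw hk hc2 hwc 0).1 \ X.1 = B := by
  induction B using Finset.induction_on with
  | empty => exact ⟨arcType hw hk hc2 hwc 0, by rw [sdiff_self, Finset.bot_eq_empty]⟩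
  | @insert t B htB ih =>
    obtain ⟨X, hX⟩ := ih ((subset_insert t B).trans hB)
    have ht0 : w t = 0 := (mem_filter.mp (hB (mem_insert_self t B))).2
    have htT : t ∈ (arcType hw hk hc2 hwc 0).1 := (mem_arcType_zero_and_notMem_one hw hk hc2 hwc ht0).1
    have htX : t ∈ X.1 := by
      by_contra h
      exact htB (hX ▸ mem_sdiff.mpr ⟨htT, h⟩)
    exact ⟨oflipCM c hc2 t X, by rw [dev_oflip_of_mem c hc2 htT htX, hX]⟩

/-! ## §2 The near zone has at least three blocks -/

/-- A single flip of the arc type has potential exactly `1` (kernel with an element `≠ 1`). [folklore] -/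
theorem bpot_oflipCM_arcType_eq_one (hw : ∀ P Q : G, w (P * Q) = w P + w Q) (hk : 1 ≤ k) (hc2 : c * c = 1) (hcen : ∀ x : G, x * c = c * x)
    (hwc : w c ≠ 0) {n : G} (hn1 : n ≠ 1) (hn : w n = 0) {s : G} (hs : s ∈ (arcType hw hk hc2 hwc 0).1) :
    bpot c (arcType hw hk hc2 hwc 0) (oflipCM c hc2 s (arcType hw hk hc2 hwc 0)) = 1 := by
  have h1 := bpot_oflipCM_rt_le_one c (arcType hw hk hc2 hwc 0) hc2 1 (by rw [rt_one]; exact hs)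
  rw [rt_one] at h1
  rcases Nat.lt_or_ge (bpot c (arcType hw hk hc2 hwc 0) (oflipCM c hc2 s (arcType hw hk hc2 hwc 0))) 1 with h0 | h0
  · exfalso
    obtain ⟨Q, hQ⟩ := exists_rt_of_bpot_eq_zero c (arcType hw hk hc2 hwc 0) (Φ := oflipCM c hc2 s (arcType hw hk hc2 hwc 0)) (by omega)
    rw [rt_arcType] at hQ
    exact oflipCM_arcType_ne_arcType hw hk hc2 hcen hwc hn1 hn s 0 _ hQ
  · omega

/-- **AT LEAST THREE NEAR BLOCKS for `k = 2`**: the arc block, the block of the bottom flips and the block of the top flips are pairwise distinct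
(kernel with an element of odd order `≠ 1`, `w` onto). [folklore] -/
theorem three_le_card_filter_bpot_le_one (hw : ∀ P Q : G, w (P * Q) = w P + w Q) (hk : 1 ≤ k) (hk2 : k = 2) (hc2 : c * c = 1)
    (hcen : ∀ x : G, x * c = c * x) (hwc : w c ≠ 0) (h1 : ∃ g₁ : G, w g₁ = 1) {n : G} (hn1 : n ≠ 1) (hn2 : n * n ≠ 1) (hn : w n = 0) :
    3 ≤ (univ.filter fun Bk : Block c => bpot c (arcType hw hk hc2 hwc 0) Bk.out ≤ 1).card := by
  obtain ⟨g₁, hg₁⟩ := h1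
  have h1T : (1 : G) ∈ (arcType hw hk hc2 hwc 0).1 := one_mem_arcType_zero hw hk hc2 hwc
  have hgT : g₁ ∈ (arcType hw hk hc2 hwc 0).1 := by
    subst hk2
    haveI : Fact (1 < 2 ^ 2) := ⟨by norm_num⟩
    rw [mem_arcType, sub_zero, hg₁]
    show (1 : ZMod (2 ^ 2)).val < 2 ^ (2 - 1)
    rw [ZMod.val_one]; norm_num
  set B0 := blk c (arcType hw hk hc2 hwc 0) with hB0
  set B1 := blk c (oflipCM c hc2 1 (arcType hw hk hc2 hwc 0)) with hB1
  set B2 := blk c (oflipCM c hc2 g₁ (arcType hw hk hc2 hwc 0)) with hB2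
  have hp0 : bpot c (arcType hw hk hc2 hwc 0) B0.out = 0 := by rw [hB0, bpot_out]; have := bpot_rt_base c (arcType hw hk hc2 hwc 0) 1; rwa [rt_one] at this
  have hp1 : bpot c (arcType hw hk hc2 hwc 0) B1.out = 1 := by rw [hB1, bpot_out]; exact bpot_oflipCM_arcType_eq_one hw hk hc2 hcen hwc hn1 hn h1T
  have hp2 : bpot c (arcType hw hk hc2 hwc 0) B2.out = 1 := by rw [hB2, bpot_out]; exact bpot_oflipCM_arcType_eq_one hw hk hc2 hcen hwc hn1 hn hgT
  have h01 : B0 ≠ B1 := fun h => by have := congrArg (fun B => bpot c (arcType hw hk hc2 hwc 0) B.out) h; simp only [hp0, hp1] at this; omega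
  have h02 : B0 ≠ B2 := fun h => by have := congrArg (fun B => bpot c (arcType hw hk hc2 hwc 0) B.out) h; simp only [hp0, hp2] at this; omega
  have h12 : B1 ≠ B2 := by
    intro h
    have h2 := (blk_oflipCM_arcType_eq_iff hw hk hc2 hwc hn1 hn2 hn ⟨g₁, hg₁⟩ 0 0 1 g₁).mp h
    rw [map_one hw, hg₁, sub_zero, sub_zero, smul_zero] at h2
    subst hk2
    revert h2
    decide
  calc 3 = ({B0, B1, B2} : Finset (Block c)).card := by
        rw [card_insert_of_notMem (by simp only [mem_insert, mem_singleton, not_or]; exact ⟨h01, h02⟩),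
          card_insert_of_notMem (by rw [mem_singleton]; exact h12), card_singleton]
    _ ≤ _ := card_le_card fun B hB => by
        rw [mem_filter]
        refine ⟨mem_univ _, ?_⟩
        rw [mem_insert, mem_insert, mem_singleton] at hB
        rcases hB with rfl | rfl | rfl
        · rw [hp0]; exact Nat.zero_le 1
        · rw [hp1]
        · rw [hp2]

end

end Summit.HodgeConjecture.CorCM.Census.CyclicCharacter
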